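import Summits.NavierStokesRegularity.OSWSelfSimilar.SheetNSLineSchochetTwoPoleSolution
import HarnessLib

/-!
# The Schochet–ALSS two-pole solution of the viscous CLM on `ℝ`: blow-up read-outs, the `(T − t)^{−2}` rate and small data

HONEST FRAMING (cell ns-blowup GROUP B «PROFILE SEARCH», zone Z3, rows Z3-E12⁻ / Z3-U of `HOME/profile/z3/CENSUS-Z3.md`;
human rulings D-0035/D-0074): **1-D MODEL (the viscous Constantin–Lax–Majda equation `ω_t = ω·Hω + ν ω_xx` on `ℝ` = gCLM/OSW
at `a = 0` with constant viscosity); not Euler, not Navier–Stokes; «violates: none — MODEL».**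

CONTENT (function variables `s, y, ω, ωx` with defining hypotheses, as in `SheetNSLineSchochetTwoPoleSolution.lean`; blow-up time
`T = (σ² − s₀²)/(40kν)`): `blowupTime_pos`, `depth_blowupTime` (`y(T) = 0`), `tendsto_depth` (`y → 0⁺` as `t ↑ T`),
`tendsto_inv_depth_pow`; `solution_x_zero_le` (`ωₓ(t,0) ≤ −24ν/y³`), `solution_at_depth_le` (`ω(t, y(t)) ≤ −6ν/y²`);
`abs_f_le`, `abs_g_le`, `solution_initial_abs_le` (depths `L, 2L`: `sup|ω₀| ≤ 123ν/L²` for `k ≤ 6`); the RATE: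
`depth_two_sided` (`10kν(T−t)/σ ≤ y ≤ 20kν(T−t)/σ`), `solution_abs_le` (`|ω| ≤ 24kν/(sy) + 24ν/y²`), `solution_rate_lower`
(`3σ²/(200k²ν)·(T−t)^{−2} ≤ |ω(t, y(t))|`), `solution_rate_upper` (`|ω(t,x)| ≤ C·(T−t)^{−2}`) — i.e. `sup|ω(t,·)| ≍ (T−t)^{−2}`,
`y ≍ T − t`: the NS-type scaling `c_l/c_ω = 1/2` of the sheet (Schochet corner, `SheetNSLineSchochetCorner`)
[cite: AmbroseLushnikovSiegelSilantyev2024, §5.1.1 (self-similar form of Schochet's solution)]. The assembled existence theorem is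
`SheetNSLineSchochetTwoPoleBlowup.viscousCLM_line_blowup_from_small_data`.
WHAT IS NOT HERE: uniqueness; anything about Navier–Stokes. No definitions, no named facts. bears_on: LADDER-NS N5 / zone Z3 → N1.
-/

noncomputable section

namespace Summit.NavierStokesRegularity.OSWSelfSimilar
namespace SheetNSLineSchochetTwoPole

open _root_.MeasureTheory Set Filter Literature.Analysis.Fourier
open scoped Real Topology

section Readouts

variable {ν k σ s₀ : ℝ} {s y : ℝ → ℝ} {ω ωx ωxx : ℝ → ℝ → ℝ}

/-! ### Blow-up read-outs: the upper pole reaches the axis at `T = (σ² − s₀²)/(40kν)` -/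

/-- The blow-up time is positive (`0 < s₀ < σ`). [folklore] -/
theorem blowupTime_pos (hν : 0 < ν) (hk0 : 0 < k) (hs₀ : 0 < s₀) (hs₀σ : s₀ < σ) :
    0 < (σ ^ 2 - s₀ ^ 2) / (40 * k * ν) := by
  apply div_pos _ (by positivity)
  nlinarith

/-- `y` is continuous. [folklore] -/
theorem continuous_depth (hs : ∀ t, s t = Real.sqrt (s₀ ^ 2 + 40 * k * ν * t))
    (hy : ∀ t, y t = (σ - s t) / 2) : Continuous y := by
  obtain rfl : y = fun t => (σ - s t) / 2 := funext hy
  obtain rfl : s = fun t => Real.sqrt (s₀ ^ 2 + 40 * k * ν * t) := funext hs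
  fun_prop

/-- At `t = T` the upper pole sits on the axis: `y(T) = 0`. [folklore] -/
theorem depth_blowupTime (hν : 0 < ν) (hk0 : 0 < k) (hσ : 0 < σ)
    (hs : ∀ t, s t = Real.sqrt (s₀ ^ 2 + 40 * k * ν * t)) (hy : ∀ t, y t = (σ - s t) / 2) :
    y ((σ ^ 2 - s₀ ^ 2) / (40 * k * ν)) = 0 := by
  have h40 : 40 * k * ν ≠ 0 := by positivity
  have hrad : s₀ ^ 2 + 40 * k * ν * ((σ ^ 2 - s₀ ^ 2) / (40 * k * ν)) = σ ^ 2 := by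
    field_simp
    ring
  rw [hy, hs, hrad, Real.sqrt_sq hσ.le]
  ring

/-- **As `t ↑ T` the upper pole depth `y(t) → 0⁺`.** [folklore] -/
theorem tendsto_depth (hν : 0 < ν) (hk0 : 0 < k) (hσ : 0 < σ)
    (hs : ∀ t, s t = Real.sqrt (s₀ ^ 2 + 40 * k * ν * t)) (hy : ∀ t, y t = (σ - s t) / 2) :
    Tendsto y (𝓝[<] ((σ ^ 2 - s₀ ^ 2) / (40 * k * ν))) (𝓝[>] 0) := by
  refine tendsto_nhdsWithin_iff.2 ⟨?_, ?_⟩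
  · have h := ((continuous_depth hs hy).tendsto ((σ ^ 2 - s₀ ^ 2) / (40 * k * ν))).mono_left
      (nhdsWithin_le_nhds (s := Iio ((σ ^ 2 - s₀ ^ 2) / (40 * k * ν))))
    rwa [depth_blowupTime hν hk0 hσ hs hy] at h
  · filter_upwards [self_mem_nhdsWithin] with t ht
    exact depth_pos hν hk0 hσ hs hy ht

/-- `1/y(t)^n → +∞` as `t ↑ T` (`n ≥ 1`). [folklore] -/
theorem tendsto_inv_depth_pow (hν : 0 < ν) (hk0 : 0 < k) (hσ : 0 < σ)
    (hs : ∀ t, s t = Real.sqrt (s₀ ^ 2 + 40 * k * ν * t)) (hy : ∀ t, y t = (σ - s t) / 2)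
    {n : ℕ} (hn : n ≠ 0) {c : ℝ} (hc : 0 < c) :
    Tendsto (fun t => c / y t ^ n) (𝓝[<] ((σ ^ 2 - s₀ ^ 2) / (40 * k * ν))) atTop := by
  have h1 : Tendsto (fun t => (y t)⁻¹) (𝓝[<] ((σ ^ 2 - s₀ ^ 2) / (40 * k * ν))) atTop :=
    tendsto_inv_nhdsGT_zero.comp (tendsto_depth hν hk0 hσ hs hy)
  have h2 := (tendsto_pow_atTop hn).comp h1
  refine ((h2.const_mul_atTop hc)).congr fun t => ?_
  simp [Function.comp, div_eq_mul_inv, inv_pow]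

/-- **Gradient blow-up at the origin: `ωₓ(t, 0) ≤ −24ν/y(t)³`** (hence `→ −∞`). [folklore] -/
theorem solution_x_zero_le (hν : 0 < ν) (hk0 : 0 < k)
    (hωx : ∀ t x, ωx t x = (-24 * k * ν / s t) * ((y t ^ 2 - x ^ 2) / (x ^ 2 + y t ^ 2) ^ 2
        - ((y t + s t) ^ 2 - x ^ 2) / (x ^ 2 + (y t + s t) ^ 2) ^ 2)
      + (-12 * ν) * (2 * y t * (y t ^ 2 - 3 * x ^ 2) / (x ^ 2 + y t ^ 2) ^ 3
        + 2 * (y t + s t) * ((y t + s t) ^ 2 - 3 * x ^ 2) / (x ^ 2 + (y t + s t) ^ 2) ^ 3))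
    {t : ℝ} (hyt : 0 < y t) (hst : 0 < s t) : ωx t 0 ≤ -(24 * ν / y t ^ 3) := by
  rw [hωx]
  have hy2 : 0 < y t + s t := by linarith
  have hyne : y t ≠ 0 := hyt.ne'
  have hy2ne : y t + s t ≠ 0 := hy2.ne'
  have e : (-24 * k * ν / s t) * ((y t ^ 2 - 0 ^ 2) / (0 ^ 2 + y t ^ 2) ^ 2
        - ((y t + s t) ^ 2 - 0 ^ 2) / (0 ^ 2 + (y t + s t) ^ 2) ^ 2)
      + (-12 * ν) * (2 * y t * (y t ^ 2 - 3 * 0 ^ 2) / (0 ^ 2 + y t ^ 2) ^ 3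
        + 2 * (y t + s t) * ((y t + s t) ^ 2 - 3 * 0 ^ 2) / (0 ^ 2 + (y t + s t) ^ 2) ^ 3)
      = (-24 * k * ν / s t) * (1 / y t ^ 2 - 1 / (y t + s t) ^ 2)
        - 24 * ν / y t ^ 3 - 24 * ν / (y t + s t) ^ 3 := by
    field_simp
    ring
  rw [e]
  have ha : -24 * k * ν / s t < 0 := div_neg_of_neg_of_pos (by nlinarith [mul_pos hk0 hν]) hst
  have h1 : 1 / (y t + s t) ^ 2 ≤ 1 / y t ^ 2 := by
    apply one_div_le_one_div_of_le (by positivity)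
    nlinarith
  have h3 : 0 < 24 * ν / (y t + s t) ^ 3 := by positivity
  nlinarith [mul_nonpos_of_nonpos_of_nonneg ha.le (sub_nonneg.2 h1)]

/-- **Amplitude blow-up: at the pole depth, `ω(t, y(t)) ≤ −6ν/y(t)²`** (hence `sup|ω(t,·)| → ∞`). [folklore] -/
theorem solution_at_depth_le (hν : 0 < ν) (hk0 : 0 < k)
    (hω : ∀ t x, ω t x = (-24 * k * ν / s t) * (x / (x ^ 2 + y t ^ 2) - x / (x ^ 2 + (y t + s t) ^ 2))
      + (-12 * ν) * (2 * y t * x / (x ^ 2 + y t ^ 2) ^ 2 + 2 * (y t + s t) * x / (x ^ 2 + (y t + s t) ^ 2) ^ 2))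
    {t : ℝ} (hyt : 0 < y t) (hst : 0 < s t) : ω t (y t) ≤ -(6 * ν / y t ^ 2) := by
  rw [hω]
  have hy2 : 0 < y t + s t := by linarith
  have hyne : y t ≠ 0 := hyt.ne'
  have ha : -24 * k * ν / s t < 0 := div_neg_of_neg_of_pos (by nlinarith [mul_pos hk0 hν]) hst
  have h1 : y t / (y t ^ 2 + (y t + s t) ^ 2) ≤ y t / (y t ^ 2 + y t ^ 2) := by
    apply div_le_div_of_nonneg_left hyt.le (by positivity)
    nlinarith
  have e : 2 * y t * y t / (y t ^ 2 + y t ^ 2) ^ 2 = 1 / (2 * y t ^ 2) := by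
    field_simp
    ring
  have h2 : 0 ≤ 2 * (y t + s t) * y t / (y t ^ 2 + (y t + s t) ^ 2) ^ 2 := by positivity
  have e2 : -(6 * ν / y t ^ 2) = (-12 * ν) * (1 / (2 * y t ^ 2)) := by
    field_simp
    ring
  rw [e, e2]
  nlinarith [mul_nonpos_of_nonpos_of_nonneg ha.le (sub_nonneg.2 h1)]

/-! ### Small data: with `y₁(0) = L`, `y₂(0) = 2L` the datum has `sup |ω₀| ≤ 123ν/L²` -/

/-- `|x/(x²+L²)| ≤ 1/(2L)`. [folklore] -/
theorem abs_f_le {L : ℝ} (hL : 0 < L) (x : ℝ) : |x / (x ^ 2 + L ^ 2)| ≤ 1 / (2 * L) := by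
  rw [abs_div, abs_of_pos (by positivity : (0:ℝ) < x ^ 2 + L ^ 2), div_le_div_iff₀ (by positivity) (by positivity)]
  nlinarith [sq_nonneg (|x| - L), sq_abs x]

/-- `|2Lx/(x²+L²)²| ≤ 1/L²`. [folklore] -/
theorem abs_g_le {L : ℝ} (hL : 0 < L) (x : ℝ) : |2 * L * x / (x ^ 2 + L ^ 2) ^ 2| ≤ 1 / L ^ 2 := by
  have hD : (0:ℝ) < x ^ 2 + L ^ 2 := by positivity
  rw [abs_div, abs_of_pos (by positivity : (0:ℝ) < (x ^ 2 + L ^ 2) ^ 2),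
    div_le_div_iff₀ (by positivity) (by positivity), abs_mul, abs_of_pos (by positivity : (0:ℝ) < 2 * L)]
  have h1 : 2 * L * |x| ≤ x ^ 2 + L ^ 2 := by nlinarith [sq_nonneg (|x| - L), sq_abs x]
  have h2 : L ^ 2 ≤ x ^ 2 + L ^ 2 := by nlinarith
  calc 2 * L * |x| * L ^ 2 ≤ (x ^ 2 + L ^ 2) * (x ^ 2 + L ^ 2) := by gcongr
    _ = 1 * (x ^ 2 + L ^ 2) ^ 2 := by ring

/-- **Small data.** For the two-pole datum with depths `L, 2L` (`σ = 3L`, `s₀ = L`) and `0 < k ≤ 6`: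
`|ω(0, x)| ≤ 123ν/L²` for every `x`. [folklore] -/
theorem solution_initial_abs_le (hν : 0 < ν) (hk0 : 0 < k) (hk6 : k ≤ 6) {L : ℝ} (hL : 0 < L)
    (hs : ∀ t, s t = Real.sqrt (L ^ 2 + 40 * k * ν * t)) (hy : ∀ t, y t = (3 * L - s t) / 2)
    (hω : ∀ t x, ω t x = (-24 * k * ν / s t) * (x / (x ^ 2 + y t ^ 2) - x / (x ^ 2 + (y t + s t) ^ 2))
      + (-12 * ν) * (2 * y t * x / (x ^ 2 + y t ^ 2) ^ 2 + 2 * (y t + s t) * x / (x ^ 2 + (y t + s t) ^ 2) ^ 2))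
    (x : ℝ) : |ω 0 x| ≤ 123 * ν / L ^ 2 := by
  have hs0 : s 0 = L := by rw [hs]; simp [Real.sqrt_sq hL.le]
  have hy0 : y 0 = L := by rw [hy, hs0]; ring
  have hy20 : y 0 + s 0 = 2 * L := by rw [hy0, hs0]; ring
  rw [hω, hy20, hy0, hs0]
  have h2L : (0:ℝ) < 2 * L := by positivity
  have hA : |(-24 * k * ν / L)| = 24 * k * ν / L := by
    rw [abs_of_neg (div_neg_of_neg_of_pos (by nlinarith [mul_pos hk0 hν]) hL)]
    ring
  have hB : |(-12 * ν : ℝ)| = 12 * ν := by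
    rw [abs_of_neg (by linarith)]
    ring
  have p1 := abs_f_le hL x
  have p2 := abs_f_le h2L x
  have p3 := abs_g_le hL x
  have p4 := abs_g_le h2L x
  calc |(-24 * k * ν / L) * (x / (x ^ 2 + L ^ 2) - x / (x ^ 2 + (2 * L) ^ 2))
        + (-12 * ν) * (2 * L * x / (x ^ 2 + L ^ 2) ^ 2 + 2 * (2 * L) * x / (x ^ 2 + (2 * L) ^ 2) ^ 2)|
      ≤ |(-24 * k * ν / L) * (x / (x ^ 2 + L ^ 2) - x / (x ^ 2 + (2 * L) ^ 2))|
        + |(-12 * ν) * (2 * L * x / (x ^ 2 + L ^ 2) ^ 2 + 2 * (2 * L) * x / (x ^ 2 + (2 * L) ^ 2) ^ 2)| :=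
        abs_add_le _ _
    _ = 24 * k * ν / L * |x / (x ^ 2 + L ^ 2) - x / (x ^ 2 + (2 * L) ^ 2)|
        + 12 * ν * |2 * L * x / (x ^ 2 + L ^ 2) ^ 2 + 2 * (2 * L) * x / (x ^ 2 + (2 * L) ^ 2) ^ 2| := by
        rw [abs_mul, abs_mul, hA, hB]
    _ ≤ 24 * k * ν / L * (1 / (2 * L) + 1 / (2 * (2 * L))) + 12 * ν * (1 / L ^ 2 + 1 / (2 * L) ^ 2) := by
        gcongr
        · exact (abs_sub _ _).trans (add_le_add p1 p2)
        · exact (abs_add_le _ _).trans (add_le_add p3 p4)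
    _ = (18 * k + 15) * ν / L ^ 2 := by
        field_simp
        ring
    _ ≤ 123 * ν / L ^ 2 := by
        apply div_le_div_of_nonneg_right _ (by positivity)
        nlinarith

/-! ### The blow-up RATE: `y(t) ≍ (T − t)`, hence `sup|ω(t,·)| ≍ (T − t)^{−2}` — the NS-type scaling `c_l/c_ω = 1/2` -/

/-- **Two-sided law of the upper pole depth:** `10kν(T−t)/σ ≤ y(t) ≤ 20kν(T−t)/σ` on `0 ≤ t ≤ T`
(from `σ² − s(t)² = 40kν(T − t)` and `σ < σ + s ≤ 2σ`). [folklore] -/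
theorem depth_two_sided (hν : 0 < ν) (hk0 : 0 < k) (hs₀ : 0 < s₀) (hs₀σ : s₀ < σ)
    (hs : ∀ t, s t = Real.sqrt (s₀ ^ 2 + 40 * k * ν * t)) (hy : ∀ t, y t = (σ - s t) / 2) {t : ℝ}
    (ht0 : 0 ≤ t) (htT : t ≤ (σ ^ 2 - s₀ ^ 2) / (40 * k * ν)) :
    10 * k * ν * ((σ ^ 2 - s₀ ^ 2) / (40 * k * ν) - t) / σ ≤ y t ∧
      y t ≤ 20 * k * ν * ((σ ^ 2 - s₀ ^ 2) / (40 * k * ν) - t) / σ := by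
  have hσ : 0 < σ := hs₀.trans hs₀σ
  have h40 : 0 < 40 * k * ν := by positivity
  have hrad : 0 ≤ s₀ ^ 2 + 40 * k * ν * t := by positivity
  have hs2 : s t ^ 2 = s₀ ^ 2 + 40 * k * ν * t := by rw [hs]; exact Real.sq_sqrt hrad
  have hspos : 0 < s t := by rw [hs]; exact Real.sqrt_pos.2 (by positivity)
  have hsσ : s t ≤ σ := by
    have : s₀ ^ 2 + 40 * k * ν * t ≤ σ ^ 2 := by
      have := (le_div_iff₀ h40).1 htT
      linarith
    rw [hs]
    calc Real.sqrt (s₀ ^ 2 + 40 * k * ν * t) ≤ Real.sqrt (σ ^ 2) := Real.sqrt_le_sqrt this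
      _ = σ := Real.sqrt_sq hσ.le
  -- `y (σ + s) = 20kν (T − t)`
  have key : y t * (σ + s t) = 20 * k * ν * ((σ ^ 2 - s₀ ^ 2) / (40 * k * ν) - t) := by
    rw [hy]
    field_simp
    nlinarith [hs2]
  have hsum : 0 < σ + s t := by linarith
  have hTt : 0 ≤ (σ ^ 2 - s₀ ^ 2) / (40 * k * ν) - t := by linarith
  have hyeq : y t = 20 * k * ν * ((σ ^ 2 - s₀ ^ 2) / (40 * k * ν) - t) / (σ + s t) := by
    rw [eq_div_iff hsum.ne']
    exact key
  rw [hyeq]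
  constructor
  · rw [div_le_div_iff₀ hσ hsum]
    nlinarith [mul_nonneg (mul_nonneg (mul_nonneg (by norm_num : (0:ℝ) ≤ 10) hk0.le) hν.le) hTt]
  · apply div_le_div_of_nonneg_left (by positivity) hσ
    linarith

/-- **Sup bound of a slice:** `|ω(t, x)| ≤ 24kν/(s(t) y(t)) + 24ν/y(t)²` for every `x`. [folklore] -/
theorem solution_abs_le (hν : 0 < ν) (hk0 : 0 < k)
    (hω : ∀ t x, ω t x = (-24 * k * ν / s t) * (x / (x ^ 2 + y t ^ 2) - x / (x ^ 2 + (y t + s t) ^ 2))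
      + (-12 * ν) * (2 * y t * x / (x ^ 2 + y t ^ 2) ^ 2 + 2 * (y t + s t) * x / (x ^ 2 + (y t + s t) ^ 2) ^ 2))
    {t : ℝ} (hyt : 0 < y t) (hst : 0 < s t) (x : ℝ) :
    |ω t x| ≤ 24 * k * ν / (s t * y t) + 24 * ν / y t ^ 2 := by
  rw [hω]
  have hy2 : 0 < y t + s t := by linarith
  have hA : |(-24 * k * ν / s t)| = 24 * k * ν / s t := by
    rw [abs_of_neg (div_neg_of_neg_of_pos (by nlinarith [mul_pos hk0 hν]) hst)]
    ring
  have hB : |(-12 * ν : ℝ)| = 12 * ν := by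
    rw [abs_of_neg (by linarith)]
    ring
  have p1 := abs_f_le hyt x
  have p2 := abs_f_le hy2 x
  have p3 := abs_g_le hyt x
  have p4 := abs_g_le hy2 x
  have q1 : 1 / (2 * (y t + s t)) ≤ 1 / (2 * y t) :=
    one_div_le_one_div_of_le (by positivity) (by linarith)
  have q2 : 1 / (y t + s t) ^ 2 ≤ 1 / y t ^ 2 :=
    one_div_le_one_div_of_le (by positivity) (by nlinarith)
  calc |(-24 * k * ν / s t) * (x / (x ^ 2 + y t ^ 2) - x / (x ^ 2 + (y t + s t) ^ 2))
        + (-12 * ν) * (2 * y t * x / (x ^ 2 + y t ^ 2) ^ 2 + 2 * (y t + s t) * x / (x ^ 2 + (y t + s t) ^ 2) ^ 2)|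
      ≤ |(-24 * k * ν / s t) * (x / (x ^ 2 + y t ^ 2) - x / (x ^ 2 + (y t + s t) ^ 2))|
        + |(-12 * ν) * (2 * y t * x / (x ^ 2 + y t ^ 2) ^ 2 + 2 * (y t + s t) * x / (x ^ 2 + (y t + s t) ^ 2) ^ 2)| :=
        abs_add_le _ _
    _ = 24 * k * ν / s t * |x / (x ^ 2 + y t ^ 2) - x / (x ^ 2 + (y t + s t) ^ 2)|
        + 12 * ν * |2 * y t * x / (x ^ 2 + y t ^ 2) ^ 2 + 2 * (y t + s t) * x / (x ^ 2 + (y t + s t) ^ 2) ^ 2| := by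
        rw [abs_mul, abs_mul, hA, hB]
    _ ≤ 24 * k * ν / s t * (1 / (2 * y t) + 1 / (2 * y t)) + 12 * ν * (1 / y t ^ 2 + 1 / y t ^ 2) := by
        gcongr
        · exact (abs_sub _ _).trans (add_le_add p1 (p2.trans q1))
        · exact (abs_add_le _ _).trans (add_le_add p3 (p4.trans q2))
    _ = 24 * k * ν / (s t * y t) + 24 * ν / y t ^ 2 := by
        field_simp
        ring

/-- **Lower blow-up rate `(T − t)^{−2}` at the pole depth:** `3σ²/(200k²ν) · (T − t)^{−2} ≤ |ω(t, y(t))|` on `0 ≤ t < T`.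
[cite: AmbroseLushnikovSiegelSilantyev2024, §5.1.1 (self-similar form, `ω ≃ −24ṽ (t_c − t)^{−2} ξ/(ξ²+ṽ²)²`)] -/
theorem solution_rate_lower (hν : 0 < ν) (hk0 : 0 < k) (hs₀ : 0 < s₀) (hs₀σ : s₀ < σ)
    (hs : ∀ t, s t = Real.sqrt (s₀ ^ 2 + 40 * k * ν * t)) (hy : ∀ t, y t = (σ - s t) / 2)
    (hω : ∀ t x, ω t x = (-24 * k * ν / s t) * (x / (x ^ 2 + y t ^ 2) - x / (x ^ 2 + (y t + s t) ^ 2))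
      + (-12 * ν) * (2 * y t * x / (x ^ 2 + y t ^ 2) ^ 2 + 2 * (y t + s t) * x / (x ^ 2 + (y t + s t) ^ 2) ^ 2))
    {t : ℝ} (ht0 : 0 ≤ t) (htT : t < (σ ^ 2 - s₀ ^ 2) / (40 * k * ν)) :
    3 * σ ^ 2 / (200 * k ^ 2 * ν) / ((σ ^ 2 - s₀ ^ 2) / (40 * k * ν) - t) ^ 2 ≤ |ω t (y t)| := by
  have hσ : 0 < σ := hs₀.trans hs₀σ
  have hyt : 0 < y t := depth_pos hν hk0 hσ hs hy htT
  have hst : 0 < s t := sep_pos hs (radicand_pos hν hk0 hs₀ ht0)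
  have hTt : 0 < (σ ^ 2 - s₀ ^ 2) / (40 * k * ν) - t := by linarith
  obtain ⟨-, hup⟩ := depth_two_sided hν hk0 hs₀ hs₀σ hs hy ht0 htT.le
  have h := solution_at_depth_le hν hk0 hω hyt hst
  have hnn : 0 ≤ 6 * ν / y t ^ 2 := by positivity
  rw [abs_of_nonpos (h.trans (neg_nonpos.2 hnn))]
  have e : 3 * σ ^ 2 / (200 * k ^ 2 * ν) / ((σ ^ 2 - s₀ ^ 2) / (40 * k * ν) - t) ^ 2
      = 6 * ν / (20 * k * ν * ((σ ^ 2 - s₀ ^ 2) / (40 * k * ν) - t) / σ) ^ 2 := by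
    field_simp
    ring
  rw [e]
  have hle : 6 * ν / (20 * k * ν * ((σ ^ 2 - s₀ ^ 2) / (40 * k * ν) - t) / σ) ^ 2 ≤ 6 * ν / y t ^ 2 := by
    apply div_le_div_of_nonneg_left (by positivity) (by positivity)
    exact pow_le_pow_left₀ hyt.le hup 2
  linarith

/-- **Upper blow-up rate `(T − t)^{−2}` of the sup norm:** `|ω(t, x)| ≤ (12σT/(5s₀) + 6σ²/(25k²ν)) · (T − t)^{−2}` for every
`x`, on `0 ≤ t < T` (`T = (σ² − s₀²)/(40kν)`). With the lower rate: `sup_x |ω(t,·)| ≍ (T − t)^{−2}` and `y ≍ T − t`, i.e.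
`C_ω = (T−t)^{−2}`, `C_l = T − t`: the NS-type scaling `c_l/c_ω = 1/2` (the Schochet corner of `SheetNSLineSchochetCorner`). [folklore] -/
theorem solution_rate_upper (hν : 0 < ν) (hk0 : 0 < k) (hs₀ : 0 < s₀) (hs₀σ : s₀ < σ)
    (hs : ∀ t, s t = Real.sqrt (s₀ ^ 2 + 40 * k * ν * t)) (hy : ∀ t, y t = (σ - s t) / 2)
    (hω : ∀ t x, ω t x = (-24 * k * ν / s t) * (x / (x ^ 2 + y t ^ 2) - x / (x ^ 2 + (y t + s t) ^ 2))
      + (-12 * ν) * (2 * y t * x / (x ^ 2 + y t ^ 2) ^ 2 + 2 * (y t + s t) * x / (x ^ 2 + (y t + s t) ^ 2) ^ 2))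
    {t : ℝ} (ht0 : 0 ≤ t) (htT : t < (σ ^ 2 - s₀ ^ 2) / (40 * k * ν)) (x : ℝ) :
    |ω t x| ≤ (12 * σ * ((σ ^ 2 - s₀ ^ 2) / (40 * k * ν)) / (5 * s₀) + 6 * σ ^ 2 / (25 * k ^ 2 * ν))
      / ((σ ^ 2 - s₀ ^ 2) / (40 * k * ν) - t) ^ 2 := by
  have hσ : 0 < σ := hs₀.trans hs₀σ
  have hyt : 0 < y t := depth_pos hν hk0 hσ hs hy htT
  have hrad : 0 < s₀ ^ 2 + 40 * k * ν * t := radicand_pos hν hk0 hs₀ ht0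
  have hst : 0 < s t := sep_pos hs hrad
  set T := (σ ^ 2 - s₀ ^ 2) / (40 * k * ν) with hTdef
  have hTt : 0 < T - t := by linarith
  have hT0 : T - t ≤ T := by linarith
  obtain ⟨hlow, -⟩ := depth_two_sided hν hk0 hs₀ hs₀σ hs hy ht0 htT.le
  have hss₀ : s₀ ≤ s t := by
    rw [hs]
    calc s₀ = Real.sqrt (s₀ ^ 2) := (Real.sqrt_sq hs₀.le).symm
      _ ≤ Real.sqrt (s₀ ^ 2 + 40 * k * ν * t) := Real.sqrt_le_sqrt (le_add_of_nonneg_right (by positivity))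
  have hylow : 0 < 10 * k * ν * (T - t) / σ := by positivity
  have h1 : 24 * k * ν / (s t * y t) ≤ 24 * k * ν / (s₀ * (10 * k * ν * (T - t) / σ)) := by
    apply div_le_div_of_nonneg_left (by positivity) (by positivity)
    exact mul_le_mul hss₀ hlow hylow.le hst.le
  have h2 : 24 * ν / y t ^ 2 ≤ 24 * ν / (10 * k * ν * (T - t) / σ) ^ 2 := by
    apply div_le_div_of_nonneg_left (by positivity) (by positivity)
    exact pow_le_pow_left₀ hylow.le hlow 2
  have h3 : 24 * k * ν / (s₀ * (10 * k * ν * (T - t) / σ)) = 12 * σ / (5 * s₀) * (T - t) / (T - t) ^ 2 := by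
    field_simp
    ring
  have h4 : 12 * σ / (5 * s₀) * (T - t) / (T - t) ^ 2 ≤ 12 * σ / (5 * s₀) * T / (T - t) ^ 2 := by
    gcongr
  have h5 : 24 * ν / (10 * k * ν * (T - t) / σ) ^ 2 = 6 * σ ^ 2 / (25 * k ^ 2 * ν) / (T - t) ^ 2 := by
    field_simp
    ring
  calc |ω t x| ≤ 24 * k * ν / (s t * y t) + 24 * ν / y t ^ 2 := solution_abs_le hν hk0 hω hyt hst x
    _ ≤ 12 * σ / (5 * s₀) * T / (T - t) ^ 2 + 6 * σ ^ 2 / (25 * k ^ 2 * ν) / (T - t) ^ 2 := by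
        linarith [h1, h2, h3, h4, h5]
    _ = (12 * σ * T / (5 * s₀) + 6 * σ ^ 2 / (25 * k ^ 2 * ν)) / (T - t) ^ 2 := by
        field_simp

end Readouts

end SheetNSLineSchochetTwoPole
end Summit.NavierStokesRegularity.OSWSelfSimilar

end
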